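import Literature.AlgebraicGeometry.HodgeTheory.AtiyahClassCoherent
import Literature.AlgebraicGeometry.HodgeTheory.BlochSemiregularityMapReal
import Literature.AlgebraicGeometry.Modules.SheafHomExact
import Literature.AlgebraicGeometry.Modules.SheafHomFrames
import Mathlib.Algebra.Homology.DerivedCategory.Ext.Map
import HarnessLib

/-!
# Yoneda powers of the Atiyah class: `At(E)^k ∈ Extᵏ(E, 𝓗om(𝒯, … 𝓗om(𝒯, E)…))`

For an `S`-scheme `X` whose cotangent sheaf `Ω¹_{X/S}` is finite locally free (e.g. `X → S` smooth)
and ANY `𝒪_X`-module `E`, we construct the powers of the torsion-safe Atiyah class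
`atiyahClass' E ∈ Ext¹(E, 𝓗om(𝒯_{X/S}, E))` of `HodgeTheory/AtiyahClassCoherent.lean`:

  `atiyahPow hΩ E k ∈ Extᵏ_{𝒪_X}(E, multiHom 𝒯 E k)`,  `multiHom 𝒯 E k = 𝓗om(𝒯, 𝓗om(𝒯, … E))`
  (`k` copies of `𝒯 = (Ω¹)^∨`; the tree's iterated internal Hom of
  `HodgeTheory/BlochSemiregularityMapReal.lean`, here with `I := 𝒯`),

by the recursion `At⁰ = 1_E`, `At^{k+1}(E) = At(E) ⋆ 𝓗om(𝒯, At^k(E))` — the Yoneda composite of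
`At(E) : E → 𝓗om(𝒯, E)[1]` with the image of `At^k(E) : E → multiHom 𝒯 E k [k]` under the EXACT
functor `𝓗om(𝒯, –)` (`Modules.sheafHomFunctor`; exact because `𝒯` is finite locally free,
`Modules.preservesFiniteColimits_sheafHomFunctor`; on `Ext` by Mathlib's `Ext.mapExactFunctor`).

This is Buchweitz–Flenner's "Taking powers gives elements `At^q(F) ∈ Ext^q_X(F, F ⊗ Ω^q_X)`" (§1)
BEFORE the projection `F ⊗ (Ω¹)^{⊗q} → F ⊗ Ω^q`: for `Ω¹` finite locally free,
`multiHom 𝒯 E k ≅ E ⊗ (Ω¹)^{⊗k}` for every `E`, and the alternating iterated homomorphisms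
`altMultiHom 𝒯 E k = 𝓗om(Λᵏ𝒯, E) ≅ E ⊗ Ωᵏ` (same file, `altι`) carry the projected powers; the
projection (antisymmetrisation, which needs `k!` invertible, or the wedge after a trace) is left
to the consumer — the semiregularity components `σ_k = Tr(∗ · Atᵏ)/k!` (BF Def. 4.1) are
insensitive to where the projection is applied, by naturality of the trace in the coefficients.
In BF's algebra `A = ⊕ Ext^i(F, F ⊗ Λʲ𝕃)` (§4, before Prop. 4.2, "associative but in general not
graded commutative") the later factors are `At ⊗ 1`; here they are `𝓗om(𝒯, –)` applied to the
earlier power, i.e. the new cotangent factor is inserted FIRST — a difference by a permutation of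
the tensor factors `(Ω¹)^{⊗k}`, invisible after antisymmetrisation up to the sign convention.

## Comparison with the tree's powers for vector bundles (stated, NOT proved here)

For `E` finite locally free the tree already has the powers in the model `𝓗om(E^∨, Ω^q)`:
`atiyahClassPower E q ∈ Ext^q(E ⊗ Ω⁰, E ⊗ Ω^q)` (Yoneda product of the step classes
`atiyahClassStep E j`, `HodgeTheory/SemiregularityHigherSigma.lean`) and
`atiyahPowReal E q ∈ Ext^q(E, twistHodge E q)` (`HodgeTheory/SemiregularityMapReal.lean`), feeding
`sigmaHigher` / `sigmaReal` / `IsSemiregularReal`. When `E` AND `Ω¹` are finite locally free, under the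
canonical isomorphisms `multiHom 𝒯 E k ≅ E ⊗ (Ω¹)^{⊗k}` (biduality, Hartshorne II Ex. 5.1) followed by
the projection `E ⊗ (Ω¹)^{⊗k} → E ⊗ ⋀ᵏΩ¹ ≅ twistHodge E k`, the class `atiyahPow hΩ E k` maps to
`atiyahPowReal E k` up to the sign fixed by the ordering of the `1`-form factors (here the new factor
is inserted first, there it is wedged on the left: `da ∧ φ`); for `k = 1` this is the comparison
`atiyahClass' E ↔ atiyahClass E ↔ atiyahPowReal E 1` stated in `AtiyahClassCoherent.lean`
(`atiyahPowReal_one` proves the second arrow). NOT proved here (needs the biduality isomorphisms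
and the compatibility of `Ext.mapExactFunctor (𝓗om(𝒯, –))` with them). For torsion `E` the older
powers live in zero groups' worth of coefficients (`E^∨ = 0`); the present ones do not.

## Contents (everything proved; no named facts)

* `preservesFiniteColimits_sheafHomFunctor_tangentSheaf` — `𝓗om(𝒯, –)` is exact;
* `atiyahPow hΩ E k`, `atiyahPow_zero`, `atiyahPow_succ`, `atiyahPow_one : At¹ = atiyahClass' E`;
* `atiyahPowComp hΩ E x k = x ⋆ At^k(E) ∈ Ext^{n+k}(E', multiHom 𝒯 E k)` for `x ∈ Extⁿ(E', E)` —
  the input of the semiregularity components `σ_k(x) = Tr(x · Atᵏ)/k!` (the trace for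
  non-locally-free `E` is not in the tree: not here).

## References

* R.-O. Buchweitz, H. Flenner, *A semiregularity map for modules and applications to deformations*,
  Compositio Math. 137 (2003), §1 (`At^q(F)`), §4 (the algebra `A`, Def. 4.1). [BuchweitzFlenner2003]
* M. F. Atiyah, Trans. AMS 85 (1957), §4. [Atiyah1957]
-/

noncomputable section

open CategoryTheory CategoryTheory.Abelian AlgebraicGeometry Opposite TopologicalSpace Limits

namespace Literature.AlgebraicGeometry.HodgeTheory

open Literature.AlgebraicGeometry.Modules Literature.AlgebraicGeometry.Motives

universe w u

section Powers

variable {S : Type u} [CommRing S] {X : Over (Spec (CommRingCat.of S))}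

/-- **`𝓗om(𝒯_{X/S}, –)` is exact** when `Ω¹_{X/S}` is finite locally free (then so is its dual
`𝒯`, `Modules.isFiniteLocallyFree_dual`, and `𝓗om` out of a finite locally free module is exact,
`Modules.preservesFiniteColimits_sheafHomFunctor`). [cite: Hartshorne1977, III.6 (proof of Prop. 6.5) and II Ex. 5.1 (b)] -/
theorem preservesFiniteColimits_sheafHomFunctor_tangentSheaf
    (hΩ : IsFiniteLocallyFree (cotangentSheaf X)) :
    PreservesFiniteColimits (sheafHomFunctor (tangentSheaf X)) :=
  preservesFiniteColimits_sheafHomFunctor _ (isFiniteLocallyFree_dual hΩ)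

variable [HasExt.{w} X.left.Modules]

/-- **The Yoneda powers of the Atiyah class** `At(E)^k ∈ Extᵏ(E, 𝓗om(𝒯, … 𝓗om(𝒯, E)…))`
(`k` copies of `𝒯 = (Ω¹_{X/S})^∨`; the target `multiHom 𝒯 E k` is `≅ E ⊗ (Ω¹)^{⊗k}` when `Ω¹` is
finite locally free), for ANY `𝒪_X`-module `E`: `At⁰ = 1_E` and
`At^{k+1}(E) = At(E) ⋆ 𝓗om(𝒯, At^k(E))`, the second factor being the image of `At^k(E)` under
the exact functor `𝓗om(𝒯, –)` on `Ext` (Mathlib `Ext.mapExactFunctor`). "Taking powers gives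
elements `At^q(F) ∈ Ext^q_X(F, F ⊗ Ω^q_X)`" — here before the projection `(Ω¹)^{⊗q} → Ω^q`.
[cite: BuchweitzFlenner2003, §1 (powers of the Atiyah class) and §4 (the algebra A)] -/
def atiyahPow (hΩ : IsFiniteLocallyFree (cotangentSheaf X)) (E : X.left.Modules) :
    (k : ℕ) → Ext.{w} E (multiHom (tangentSheaf X) E k) k
  | 0 => Ext.mk₀ (𝟙 E)
  | k + 1 =>
    haveI := preservesFiniteColimits_sheafHomFunctor_tangentSheaf hΩ
    (atiyahClass' E).comp
      ((atiyahPow hΩ E k).mapExactFunctor (sheafHomFunctor (tangentSheaf X))) (Nat.add_comm 1 k)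

variable (hΩ : IsFiniteLocallyFree (cotangentSheaf X)) (E : X.left.Modules)

/-- `At⁰ = 1_E` (the unit of the algebra `A`). [cite: BuchweitzFlenner2003, §4 (the algebra A)] -/
@[simp]
lemma atiyahPow_zero : atiyahPow hΩ E 0 = Ext.mk₀ (𝟙 E) := rfl

/-- `At^{k+1}(E) = At(E) ⋆ 𝓗om(𝒯, At^k(E))`. [cite: BuchweitzFlenner2003, §1] -/
lemma atiyahPow_succ (k : ℕ) :
    atiyahPow hΩ E (k + 1) =
      haveI := preservesFiniteColimits_sheafHomFunctor_tangentSheaf hΩ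
      (atiyahClass' E).comp
        ((atiyahPow hΩ E k).mapExactFunctor (sheafHomFunctor (tangentSheaf X))) (Nat.add_comm 1 k) :=
  rfl

/-- `At¹(E) = At(E)` (the torsion-safe Atiyah class `atiyahClass' E`). [cite: BuchweitzFlenner2003, §1] -/
@[simp]
lemma atiyahPow_one : atiyahPow hΩ E 1 = atiyahClass' E := by
  haveI := preservesFiniteColimits_sheafHomFunctor_tangentSheaf hΩ
  change (atiyahClass' E).comp ((Ext.mk₀ (𝟙 E) : Ext.{w} E E 0).mapExactFunctor
    (sheafHomFunctor (tangentSheaf X))) (Nat.add_comm 1 0) = atiyahClass' E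
  have h : (sheafHomFunctor (tangentSheaf X)).map (𝟙 E) = 𝟙 _ :=
    CategoryTheory.Functor.map_id _ _
  rw [Ext.mapExactFunctor_mk₀, h]
  exact Ext.comp_mk₀_id _

/-- **`x ⋆ At^k(E) ∈ Ext^{n+k}(E', 𝓗om(𝒯, … E))`** for `x ∈ Extⁿ(E', E)`: the argument of the
semiregularity component `σ_k(x) = Tr(x · At(E)^k)/k!` (BF Def. 4.1; for `E' = E`, `n = 2`).
[cite: BuchweitzFlenner2003, Def. 4.1] -/
def atiyahPowComp {E' : X.left.Modules} {n : ℕ} (x : Ext.{w} E' E n) (k : ℕ) :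
    Ext.{w} E' (multiHom (tangentSheaf X) E k) (n + k) :=
  x.comp (atiyahPow hΩ E k) rfl

/-- `x ⋆ At⁰ = x` (`At⁰` is the unit of `A`). [cite: BuchweitzFlenner2003, §4 (the algebra A)] -/
@[simp]
lemma atiyahPowComp_zero {E' : X.left.Modules} {n : ℕ} (x : Ext.{w} E' E n) :
    atiyahPowComp hΩ E x 0 = x := by
  rw [atiyahPowComp, atiyahPow_zero]
  exact Ext.comp_mk₀_id _

/-- `x ⋆ At¹ = x ⋆ At(E)` — the argument of `σ₁(x) = Tr(x · At)`. [cite: BuchweitzFlenner2003, Def. 4.1] -/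
lemma atiyahPowComp_one {E' : X.left.Modules} {n : ℕ} (x : Ext.{w} E' E n) :
    atiyahPowComp hΩ E x 1 = x.comp (atiyahClass' E) rfl := by
  rw [atiyahPowComp, atiyahPow_one]
  rfl

/-- `atiyahPowComp` is additive in `x` (the Yoneda product of `A` is biadditive). [cite: BuchweitzFlenner2003, §4 (the algebra A)] -/
lemma atiyahPowComp_add {E' : X.left.Modules} {n : ℕ} (x y : Ext.{w} E' E n) (k : ℕ) :
    atiyahPowComp hΩ E (x + y) k = atiyahPowComp hΩ E x k + atiyahPowComp hΩ E y k := by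
  rw [atiyahPowComp, atiyahPowComp, atiyahPowComp, Ext.add_comp]

end Powers

end Literature.AlgebraicGeometry.HodgeTheory

end
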